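import Summits.QuantumFields.BalabanUV.Beta.FP.PerfectPropagatorRemainderSymbolN
import Summits.QuantumFields.BalabanUV.Beta.FP.PerfectRemainderSliceLocal

/-!
# `BalabanUV.Beta.FP.PerfectPropagatorRemainderSymbolNPeriodic` — road «FP» for binder row D1, leaf H2-P of the horizontal route, sub-row H2-P-CHAIN-N (owner
# assignment 2026-08-20; routing F-FP-5-1), PART 3d: the remaining rows of the integration-by-parts tool (`FP/PuncturedCoordDerivMajorant`, resp.
# `FP/PuncturedCoordDeriv`) for the EVERY-ORDER members `remSlN wInf s i α β n` of the perfect propagator's remainder symbol along a zone slice: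
# endpoint PERIODICITY (`hper`), the chain on the whole open interval `U = (−(π+δ₁₆₆), π+δ₁₆₆)` (`hder`) and CONTINUITY on `U ⊇ [−π, π]` (`hcont`).

HONEST DEPENDENCY (page 1, mandatory): continuum YM on T⁴ ⇐ BetaPertH ∧ nine spine estimates (0/9 proved); BetaPertH ⇐ (D1) ∧ (D4) ∧ CAP+tail;
G-an2-4 gates asym, D1 and NE2/3/4.  HONEST FRAMING (cell contract, verbatim): «discharging `BetaPertH` makes Bałaban's UV stability UNCONDITIONAL —
a real constructive-QFT result; it is NOT the continuum limit and NOT the Clay problem.»  THIS MODULE DISCHARGES NOTHING of the wall: [folklore] bookkeeping —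
Mathlib `iteratedDeriv_comp_add_const` ∕ `Filter.EventuallyEq.iteratedDeriv_eq` applied to gan24-formalise-leaf-05-g35's `2π`-periodicity of the Feynman ∕ excess
slice matrices near the left side (`FP/PerfectRemainderSliceLocal.feyn_slice_add_two_pi`, `excess_slice_add_two_pi`, `fD_add_two_pi`, `hdet_wInf_U`,
`V_subset_U`, `V_add_two_pi_mem_U`, `Icc_subset_U`), gan24-p3-g16's local regularity `FP/PerfectSymbolDerivN.contDiffOn_perfect_feyn∕excess_entryN`, and the
chain `FP/RemainderSymbolSliceN.hasDerivAt_remSlN` (this lineage).  0 def; 0 `def … : Prop`; nothing cited; 0 sorry; 0 wall binders; NOT D1, NOT BetaPertH,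
NOT continuum, NOT Clay.

ABSOLUTE RULE (cell charter, verbatim): «No internally-minted statement may enter as a cited fact. Every hypothesis is either kernel-proved in this package or a
verbatim quotation of a PUBLISHED theorem with page reference. The manuscript(s) under audit are NOT citable for their own disputed steps — they are the thing
under adjudication; programme-internal (2001/route/tribunal) claims are never citable.»

WHAT (`wInf` = Re W_∞ on real momenta; `U := Ioo (−(π+δ)) (π+δ)`, `V := Ioo (−π−δ) (−π+δ)`, `δ = delta166 (d+1)`; rows: `hq : i.removeNth s ∈ BZ d`, `hq0 : i.removeNth s ≠ 0`,
resp. `hs : s ∈ BZ (d+1)`).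
* §1 `bSlN_congr` [folklore]: the binomial members `bSlN P M z α β n` at two points agree when the member VALUES `P j`, `M j`, `z j` (`j ≤ n`) agree there.
* §2 `invSl_wInf_add_two_pi`, `excSl_wInf_add_two_pi`, `zSlN_add_two_pi` (`t ∈ V`, every `j`) and **`remSlN_wInf_add_two_pi`**:
  `remSlN wInf s i α β n (t + 2π) = remSlN wInf s i α β n t` for `t ∈ V`; **`remSlN_wInf_neg_pi_eq_pi`**: `remSlN … n (−π) = remSlN … n π` (every `n`) — `hper`.
* §3 **`hasDerivAt_remSlN_wInf_U (N) hs hq0 (ht : t ∈ U) (hn : n < N)`** — the chain on all of `U` (invertibility there by `hdet_wInf_U`) — `hder`;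
  **`continuousOn_remSlN_wInf_U`** ∕ **`continuousOn_remSlN_wInf_Icc`** (`n < N`; for the top member of a length-`r` chain take `N = r + 1`) — `hcont`.

Provenance: binder row D1 formalisation swarm, lineage beta-d1-formalise-leaf-01, gen 8 (prover-b2b-balaban-beta-d1-formalise-leaf-01-g8-0), 2026-08-20;
sub-row H2-P-CHAIN-N of road FP (owner b2b-balaban-beta-d1-p3); INTENT journal l.22245.
-/

noncomputable section

namespace Summit.QuantumFields.BalabanUV.Beta.FP.PerfectPropagatorRemainderSymbolNPeriodic

open Complex Finset Set Filter Matrix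
open scoped Matrix.Norms.Operator BigOperators ComplexConjugate Topology
open Literature.MathematicalPhysics.QuantumFieldTheory.Balaban1983to89
open B4Strip (ofRealVec)
open B4ContourShift (BZ)
open B5Prop11Fiber (d1Sym)
open Summit.QuantumFields.BalabanUV.Beta.FP.PerfectPropagatorSymbol (feynMat maxwellMat)
open Summit.QuantumFields.BalabanUV.Beta.FP.PerfectSymbol166StripReg (delta166 delta166_pos)
open Summit.QuantumFields.BalabanUV.Beta.FP.SliceChainN (mmN ssN fst_le_of_mem_antidiagonal snd_le_of_mem_antidiagonal)
open Summit.QuantumFields.BalabanUV.Beta.FP.RemainderSymbolChainN (uSlN bSlN)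
open Summit.QuantumFields.BalabanUV.Beta.FP.RemainderSymbolSlice (excSl)
open Summit.QuantumFields.BalabanUV.Beta.FP.DispersionSliceChain (fD)
open Summit.QuantumFields.BalabanUV.Beta.FP.RemainderSymbolSliceN (feynC invSl zSlN remSlN hasDerivAt_remSlN)
open Summit.QuantumFields.BalabanUV.Beta.FP.PerfectSymbolDerivN (contDiffOn_perfect_feyn_entryN contDiffOn_perfect_excess_entryN)
open Summit.QuantumFields.BalabanUV.Beta.FP.PerfectPropagatorRemainderSymbol (wInf)
open Summit.QuantumFields.BalabanUV.Beta.FP.PerfectRemainderSliceLocal (feyn_slice_add_two_pi excess_slice_add_two_pi fD_add_two_pi hdet_wInf_U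
  V_subset_U V_add_two_pi_mem_U Icc_subset_U)

variable {d : ℕ}

/-! ## §1 Pointwise congruence of the binomial members -/

/-- [folklore] the binomial members at two points agree when all member values of order `≤ n` agree there. -/
theorem bSlN_congr {ι : Type*} [Fintype ι] [DecidableEq ι] {P M : ℕ → ℝ → Matrix ι ι ℂ} {z : ℕ → ℝ → ℂ} {n : ℕ} {t₁ t₂ : ℝ}
    (hP : ∀ j ≤ n, P j t₁ = P j t₂) (hM : ∀ j ≤ n, M j t₁ = M j t₂) (hz : ∀ j ≤ n, z j t₁ = z j t₂) (α β : ι) :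
    bSlN P M z α β n t₁ = bSlN P M z α β n t₂ := by
  have hu : ∀ j ≤ n, uSlN P M α β j t₁ = uSlN P M α β j t₂ := by
    intro j hj
    have hm : mmN P M j t₁ = mmN P M j t₂ := by
      unfold mmN
      refine Finset.sum_congr rfl fun kl hkl => ?_
      rw [hP kl.1 ((fst_le_of_mem_antidiagonal hkl).trans hj), hM kl.2 ((snd_le_of_mem_antidiagonal hkl).trans hj)]
    unfold uSlN
    rw [hm]
  have hsum : ssN (uSlN P M α β) z n t₁ = ssN (uSlN P M α β) z n t₂ := by
    unfold ssN
    refine Finset.sum_congr rfl fun ij hij => ?_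
    rw [hu ij.1 (fst_le_of_mem_antidiagonal hij), hz ij.2 (snd_le_of_mem_antidiagonal hij)]
  unfold bSlN
  rw [hsum]

/-! ## §2 Periodicity near the left side; the endpoint row `hper` -/

section Periodic

variable {s : Fin (d + 1) → ℝ} {i : Fin (d + 1)} (hq : i.removeNth s ∈ BZ d)

/-- [folklore] `V` is open. -/
theorem isOpen_V : IsOpen (Ioo (-Real.pi - delta166 (d + 1)) (-Real.pi + delta166 (d + 1))) := isOpen_Ioo

/-- [folklore] `−π ∈ V`. -/
theorem neg_pi_mem_V : (-Real.pi) ∈ Ioo (-Real.pi - delta166 (d + 1)) (-Real.pi + delta166 (d + 1)) := by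
  have hδ := delta166_pos (d + 1); exact ⟨by linarith, by linarith⟩

include hq in
/-- [our object] the Feynman curve is `2π`-periodic near the left side, EVENTUALLY: `feynC (· + 2π) =ᶠ[𝓝 t] feynC` for `t ∈ V`. -/
theorem feynC_comp_add_two_pi_eventuallyEq {t : ℝ} (ht : t ∈ Ioo (-Real.pi - delta166 (d + 1)) (-Real.pi + delta166 (d + 1))) :
    (fun u : ℝ => (feynC (wInf (d := d)) s i (u + 2 * Real.pi))⁻¹) =ᶠ[𝓝 t] fun u : ℝ => (feynC (wInf (d := d)) s i u)⁻¹ := by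
  filter_upwards [isOpen_V.mem_nhds ht] with u hu
  unfold feynC
  rw [feyn_slice_add_two_pi hq hu]

include hq in
/-- [our object] **THE INVERSE MEMBERS ARE `2π`-PERIODIC NEAR THE LEFT SIDE**: `invSl wInf s i j (t + 2π) = invSl wInf s i j t` for `t ∈ V`, every `j`. -/
theorem invSl_wInf_add_two_pi (j : ℕ) {t : ℝ} (ht : t ∈ Ioo (-Real.pi - delta166 (d + 1)) (-Real.pi + delta166 (d + 1))) :
    invSl (wInf (d := d)) s i j (t + 2 * Real.pi) = invSl (wInf (d := d)) s i j t := by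
  unfold invSl
  have h1 := congrFun (iteratedDeriv_comp_add_const (n := j) (f := fun v : ℝ => (feynC (wInf (d := d)) s i v)⁻¹) (s := 2 * Real.pi)) t
  rw [← h1]
  exact (feynC_comp_add_two_pi_eventuallyEq hq ht).iteratedDeriv_eq j

include hq in
/-- [our object] **THE EXCESS MEMBERS ARE `2π`-PERIODIC NEAR THE LEFT SIDE** (entrywise): `excSl wInf s i j (t + 2π) γ β = excSl wInf s i j t γ β`, `t ∈ V`. -/
theorem excSl_wInf_add_two_pi (j : ℕ) {t : ℝ} (ht : t ∈ Ioo (-Real.pi - delta166 (d + 1)) (-Real.pi + delta166 (d + 1))) (γ β : Fin (d + 1)) :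
    excSl (wInf (d := d)) s i j (t + 2 * Real.pi) γ β = excSl (wInf (d := d)) s i j t γ β := by
  unfold excSl
  set g : ℝ → ℂ := fun u : ℝ => maxwellMat (fun μ ν => wInf μ ν (Function.update s i u) - 1) (d1Sym (Function.update s i u)) γ β with hg
  have h1 := congrFun (iteratedDeriv_comp_add_const (n := j) (f := g) (s := 2 * Real.pi)) t
  have hev : (fun u : ℝ => g (u + 2 * Real.pi)) =ᶠ[𝓝 t] g := by
    filter_upwards [isOpen_V.mem_nhds ht] with u hu
    simp only [hg]
    rw [excess_slice_add_two_pi hq hu]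
  have h2 := hev.iteratedDeriv_eq j
  rw [h1] at h2
  exact h2

/-- [folklore] the reciprocal-dispersion members are `2π`-periodic everywhere. -/
theorem zSlN_add_two_pi (j : ℕ) (t : ℝ) : zSlN s i j (t + 2 * Real.pi) = zSlN s i j t := by
  unfold zSlN
  have hper : (fun u : ℝ => (fD (i.removeNth s) i (u + 2 * Real.pi))⁻¹) = fun u : ℝ => (fD (i.removeNth s) i u)⁻¹ := by
    funext u; rw [fD_add_two_pi]
  have h1 := congrFun (iteratedDeriv_comp_add_const (n := j) (f := fun u : ℝ => (fD (i.removeNth s) i u)⁻¹) (s := 2 * Real.pi)) t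
  rw [hper] at h1
  rw [h1]

include hq in
/-- [our object] **THE REMAINDER-SYMBOL MEMBERS ARE `2π`-PERIODIC NEAR THE LEFT SIDE**: `remSlN wInf s i α β n (t + 2π) = remSlN wInf s i α β n t` for `t ∈ V`,
every `n`. -/
theorem remSlN_wInf_add_two_pi (n : ℕ) {t : ℝ} (ht : t ∈ Ioo (-Real.pi - delta166 (d + 1)) (-Real.pi + delta166 (d + 1))) (α β : Fin (d + 1)) :
    remSlN (wInf (d := d)) s i α β n (t + 2 * Real.pi) = remSlN (wInf (d := d)) s i α β n t := by
  unfold remSlN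
  exact bSlN_congr (fun j _ => invSl_wInf_add_two_pi hq j ht) (fun j _ => funext fun γ => funext fun β' => excSl_wInf_add_two_pi hq j ht γ β')
    (fun j _ => zSlN_add_two_pi j t) α β

include hq in
/-- [our object] **THE ENDPOINT ROW `hper` AT EVERY ORDER**: `remSlN wInf s i α β n (−π) = remSlN wInf s i α β n π`. -/
theorem remSlN_wInf_neg_pi_eq_pi (n : ℕ) (α β : Fin (d + 1)) :
    remSlN (wInf (d := d)) s i α β n (-Real.pi) = remSlN (wInf (d := d)) s i α β n Real.pi := by
  have h := remSlN_wInf_add_two_pi hq n neg_pi_mem_V α β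
  have e : -Real.pi + 2 * Real.pi = Real.pi := by ring
  rw [e] at h
  exact h.symm

end Periodic

/-! ## §3 The chain and continuity on the whole open interval `U` -/

section OnU

variable {s : Fin (d + 1) → ℝ} {i : Fin (d + 1)} (hs : s ∈ BZ (d + 1)) (hq0 : i.removeNth s ≠ 0)

include hs hq0 in
/-- [our object] **THE CHAIN ON ALL OF `U`**: for `t ∈ U = Ioo (−(π+δ)) (π+δ)` and `n < N`, `(remSlN wInf s i α β n)′(t) = remSlN wInf s i α β (n+1) t`
(invertibility on `U` by `PerfectRemainderSliceLocal.hdet_wInf_U`). -/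
theorem hasDerivAt_remSlN_wInf_U (N : ℕ) {t : ℝ} (ht : t ∈ Ioo (-(Real.pi + delta166 (d + 1))) (Real.pi + delta166 (d + 1))) {n : ℕ}
    (hn : n < N) (α β : Fin (d + 1)) :
    HasDerivAt (remSlN (wInf (d := d)) s i α β n) (remSlN (wInf (d := d)) s i α β (n + 1) t) t := by
  have hq : i.removeNth s ∈ BZ d := PerfectSymbol166RealLineRe.removeNth_mem_BZ i hs
  have hU : IsOpen (Ioo (-(Real.pi + delta166 (d + 1))) (Real.pi + delta166 (d + 1))) := isOpen_Ioo
  have hfeyn : ∀ γ β', ContDiffAt ℝ N (fun u : ℝ => feynMat (fun μ ν => wInf μ ν (Function.update s i u)) (d1Sym (Function.update s i u)) γ β') t :=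
    fun γ β' => (contDiffOn_perfect_feyn_entryN N hs i γ β').contDiffAt (hU.mem_nhds ht)
  have hexc : ∀ γ β', ContDiffAt ℝ N
      (fun u : ℝ => maxwellMat (fun μ ν => wInf μ ν (Function.update s i u) - 1) (d1Sym (Function.update s i u)) γ β') t :=
    fun γ β' => (contDiffOn_perfect_excess_entryN N hs i γ β').contDiffAt (hU.mem_nhds ht)
  have hdet : IsUnit (feynC (wInf (d := d)) s i t).det := by
    unfold feynC; exact hdet_wInf_U hq hq0 ht
  exact hasDerivAt_remSlN hfeyn hexc hdet hq hq0 hn α β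

include hs hq0 in
/-- [our object] **CONTINUITY ON `U`** of every member of order `n < N`. -/
theorem continuousOn_remSlN_wInf_U (N : ℕ) {n : ℕ} (hn : n < N) (α β : Fin (d + 1)) :
    ContinuousOn (remSlN (wInf (d := d)) s i α β n) (Ioo (-(Real.pi + delta166 (d + 1))) (Real.pi + delta166 (d + 1))) :=
  fun _ ht => (hasDerivAt_remSlN_wInf_U hs hq0 N ht hn α β).continuousAt.continuousWithinAt

include hs hq0 in
/-- [our object] **THE `hcont` ROW**: continuity on `[−π, π]` (indeed on `uIcc (−π) π`) of every member of order `n < N`. -/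
theorem continuousOn_remSlN_wInf_Icc (N : ℕ) {n : ℕ} (hn : n < N) (α β : Fin (d + 1)) :
    ContinuousOn (remSlN (wInf (d := d)) s i α β n) (Icc (-Real.pi) Real.pi) :=
  (continuousOn_remSlN_wInf_U hs hq0 N hn α β).mono Icc_subset_U

end OnU

end Summit.QuantumFields.BalabanUV.Beta.FP.PerfectPropagatorRemainderSymbolNPeriodic

end
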